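import Summits.CriticalPhenomena.CardyFormulaZ2.Theses.CardyMagicRigidity
import Literature.Probability.Percolation.ClusterOuterBoundary
import Literature.Probability.Percolation.CardyFormula
import Literature.Probability.Percolation.SitePaths

/-!
# Sketch — crux-ideate stmt-CriticalPhenomena-4837 (LoopsToCrossings), ideator 2, round 1

First-lemma signatures for the idea cards `quad-implant-separation` and `oracle-sandwich`.
Nothing here is proved; every `def … : Prop` only has to elaborate over existing declarations.
-/

namespace Summit.CriticalPhenomena.CardyFormulaZ2.Cruxes.LoopsToCrossings.IdeaSketch

open Literature.Probability.Percolation Literature.Probability.LatticeModels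
  Literature.Probability.RandomPlanarGeometry MeasureTheory

/-! ## Card `quad-implant-separation` -/

/-- (A1) **Two-point separation is exactly `d_CN`-stable.** If `d_CN(c, c') ≤ η` in DKKMO's
printed sense and a loop `u` of `c` of type `i`, lying in the window, stays `η`-away from the two
reference points and has different winding numbers at them, then some loop of `c'` of the same type
also has different winding numbers at them (the sign ambiguity of the unoriented distance `udist`
flips both winding numbers at once). Provable from `UnbasedLoop.wind_eq_of_dist_lt` /
`wind_reverse`. -/
def SepStable : Prop :=
  ∀ (η : ℝ) (c c' : LoopConfig ℂ) (z₁ z₂ : ℂ) (i : Fin 2) (u : UnbasedLoop ℂ),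
    0 < η → LoopConfig.IsClose η c c' → u ∈ c.F i → u.range ⊆ Metric.ball (0 : ℂ) (1 / η) →
    η < Metric.infDist z₁ u.range → η < Metric.infDist z₂ u.range → u.wind z₁ ≠ u.wind z₂ →
    ∃ u' ∈ c'.F i, u'.wind z₁ ≠ u'.wind z₂

/-- (A2) **Two-point criterion (bond `ℤ²`)**: in a configuration with finitely many open lattice
edges, two vertices are in the same open cluster iff NO interface loop has different winding
numbers at them. `→` is `IsInterfaceLoop.wind_eq_of_reachable`; `←` uses
`exists_isInterfaceLoop_around_openCluster` for both clusters and the nesting dichotomy. -/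
def TwoPointCriterionZ2 : Prop :=
  ∀ (ω : BondConfig (Site 2)), ω ⊆ (zdGraph 2).edgeSet → ω.Finite → ∀ x y : Site 2,
    ((openGraph ω ⊓ zdGraph 2).Reachable x y ↔
      ∀ γ : List MedialVertex, IsInterfaceLoop ω γ →
        (loopCurve 1 0 γ).wind (meshPoint 1 x) = (loopCurve 1 0 γ).wind (meshPoint 1 y))

/-- The plate region of the arc `A` of `Ω` at width `s`, corner margin `r`: points outside `Ω̄`,
`s`-close to `A`, and closer to `A` than to the rest of `∂Ω` by at least `r`. -/
def plate (Ω A : Set ℂ) (s r : ℝ) : Set ℂ :=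
  {z | z ∉ closure Ω ∧ Metric.infDist z A < s ∧ Metric.infDist z A + r < Metric.infDist z (frontier Ω \ A)}

/-- **The quad implant (bond side).** Keep `ω` on the edges of G02's discrete domain `Ω_δ`, open
every lattice edge with an endpoint in the plates of the two target arcs, close everything else. -/
def implantZ2 (Ω P : Set ℂ) (δ : ℝ) (ω : BondConfig (Site 2)) : BondConfig (Site 2) :=
  {e | e ∈ ω ∧ e ∈ (discreteDomainGraph Ω δ).edgeSet} ∪
    {e | e ∈ (zdGraph 2).edgeSet ∧ ∃ x ∈ e, meshPoint δ x ∈ P}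

/-- (A3) **Implant criterion, robust half (every Jordan `R`, no smoothness)**: plate-to-plate
connectivity in the implanted configuration gives G02's crossing event, as soon as `2δ < r`.
(The bond analogue, in plate form, of Bollobás–Riordan Claim 19 / tree `mem_triCrossing_of_pathIn`.) -/
def ImplantGivesCrossingZ2 : Prop :=
  ∀ (R : ConformalRectangle) (s r δ : ℝ), 0 < δ → 2 * δ < r →
    ∀ (ω : BondConfig (Site 2)) (xA xC : Site 2),
      meshPoint δ xA ∈ plate R.carrier (R.arc 0) s r → meshPoint δ xC ∈ plate R.carrier (R.arc 2) s r →
      (openGraph (implantZ2 R.carrier (plate R.carrier (R.arc 0) s r ∪ plate R.carrier (R.arc 2) s r) δ ω)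
          ⊓ zdGraph 2).Reachable xA xC →
      ω ∈ discreteCrossing R.carrier δ (R.arc 0) (R.arc 2)

/-- (A4) **Crossing = no separating loop of the implant (bond side, robust half)**: combining (A2)
with (A3) at mesh `δ` (rescale by `δ`): if no interface loop of the implanted configuration has
different winding numbers at the two plate reference points, then `ω` crosses `(Ω; A, C)` in G02's
sense. The converse half (crossing ⇒ no separating loop) holds off corner events for `C¹`/polygonal
`R` and is where smoothness enters. -/
def NoSepLoopGivesCrossingZ2 : Prop :=
  ∀ (R : ConformalRectangle) (s r δ : ℝ), 0 < δ → 2 * δ < r →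
    ∀ (ω : BondConfig (Site 2)) (xA xC : Site 2), ω ⊆ (zdGraph 2).edgeSet →
      meshPoint δ xA ∈ plate R.carrier (R.arc 0) s r → meshPoint δ xC ∈ plate R.carrier (R.arc 2) s r →
      (∀ γ : List MedialVertex,
        IsInterfaceLoop (implantZ2 R.carrier (plate R.carrier (R.arc 0) s r ∪ plate R.carrier (R.arc 2) s r) δ ω) γ →
          (loopCurve δ 0 γ).wind (meshPoint δ xA) = (loopCurve δ 0 γ).wind (meshPoint δ xC)) →
      ω ∈ discreteCrossing R.carrier δ (R.arc 0) (R.arc 2)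

/-- **The quad implant (site-`𝕋` side), dotted.** Keep `cfg` on the sites of G02's `Ω_δ ⊆ δ𝕋`;
plate sites open EXCEPT the isolated sublattice `3ℤ × 3ℤ` of "dots" (closed), all other sites
closed EXCEPT the dots (open). The dots reproduce, on `𝕋`, the microscopic loops that the bond
implant carries deterministically (type-`0` face loops inside the all-open plates, type-`1` vertex
loops in the all-closed exterior), so that `d_CN`-closeness of the two implanted configurations
is decided by their macroscopic loops only; dots are pairwise non-adjacent, so plates stay
open-connected and the exterior has no infinite open cluster. -/
def implantT (Ω P : Set ℂ) (δ : ℝ) (cfg : SiteConfig (Site 2)) : SiteConfig (Site 2) :=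
  {x | x ∈ cfg ∧ x ∈ triMeshDomain Ω δ} ∪
    {x | triMeshPoint δ x ∈ P ∧ ¬ ((3 : ℤ) ∣ x 0 ∧ (3 : ℤ) ∣ x 1)} ∪
    {x | triMeshPoint δ x ∉ P ∧ x ∉ triMeshVertices Ω δ ∧ ((3 : ℤ) ∣ x 0 ∧ (3 : ℤ) ∣ x 1)}

/-- The typed (by orientation) unbased loop configuration of a site configuration on `δ𝕋`, as in
the route's target `LoopLimitZ2EqT`. -/
def siteTypedLoops (δ : ℝ) (cfg : SiteConfig (Site 2)) : LoopConfig ℂ :=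
  ⟨fun i ↦ {u : UnbasedLoop ℂ | ∃ (v : HexVertex) (γ : hexGraph.Walk v v),
    IsSiteInterfaceLoop cfg γ ∧ (i = 1 ↔ 0 < shoelace (γ.support.map hexCenter)) ∧
    u = UnbasedLoop.mk (BasedLoop.mk (siteLoopCurve δ γ) (isLoop_siteLoopCurve δ γ))}⟩

/-- (A5) **Implant continuity = the transferred crux `C⁺` (loop form).** `X` (the hypothesis of
`LoopsToCrossings`) implies that the typed loop configurations of the two IMPLANTED
configurations are `d_CN`-close in law. Typed here for every conformal rectangle; the crux-plan
must restrict `R` to `C¹` / axis-parallel polygonal boundaries (for wild `R` the boundary-site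
count in the near-touch estimate is not `O(1/η)`; wild `R` is the business of card
`oracle-sandwich`). -/
def ImplantContinuity : Prop :=
  Summit.CriticalPhenomena.CardyFormulaZ2.Theses.CardyMagicRigidity.LoopLimitZ2EqT →
    ∀ (R : ConformalRectangle) (s r : ℝ), 0 < r → r < s →
      Filter.Tendsto (fun δ : ℝ ↦ LoopConfig.cnLawEDist
          (bondPercolation (zdGraph 2) half)
          (fun ω ↦ bondLoopConfig δ 0
            (implantZ2 R.carrier (plate R.carrier (R.arc 0) s r ∪ plate R.carrier (R.arc 2) s r) δ ω))
          (triSitePercolation half)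
          (fun cfg ↦ siteTypedLoops δ
            (implantT R.carrier (plate R.carrier (R.arc 0) s r ∪ plate R.carrier (R.arc 2) s r) δ cfg)))
        (nhdsWithin 0 (Set.Ioi 0)) (nhds 0)

/-- (A6) **Plate transfer = the transferred crux `C⁺` (probability form, junk-free).** `X` implies
that the plate-connectivity probabilities of the two implants agree asymptotically, for plate
reference vertices at depth `≥ s/2`. This is what the assembly consumes; it follows from (A5) via
(A1)+(A2) (and their `𝕋` twins), or directly from `X` on the coupling event by the same two
lemmas plus single-lattice boundary regularity. -/
def PlateTransfer : Prop :=
  Summit.CriticalPhenomena.CardyFormulaZ2.Theses.CardyMagicRigidity.LoopLimitZ2EqT →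
    ∀ (R : ConformalRectangle) (s r ε : ℝ), 0 < r → r < s → 0 < ε →
      ∀ᶠ δ in nhdsWithin (0 : ℝ) (Set.Ioi 0), ∀ (xA xC yA yC : Site 2),
        meshPoint δ xA ∈ plate R.carrier (R.arc 0) s r → meshPoint δ xC ∈ plate R.carrier (R.arc 2) s r →
        triMeshPoint δ yA ∈ plate R.carrier (R.arc 0) s r → triMeshPoint δ yC ∈ plate R.carrier (R.arc 2) s r →
        s / 2 < Metric.infDist (meshPoint δ xA) (plate R.carrier (R.arc 0) s r)ᶜ →
        s / 2 < Metric.infDist (meshPoint δ xC) (plate R.carrier (R.arc 2) s r)ᶜ →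
        s / 2 < Metric.infDist (triMeshPoint δ yA) (plate R.carrier (R.arc 0) s r)ᶜ →
        s / 2 < Metric.infDist (triMeshPoint δ yC) (plate R.carrier (R.arc 2) s r)ᶜ →
        |(bondPercolation (zdGraph 2) half).real
            {ω | (openGraph (implantZ2 R.carrier
                (plate R.carrier (R.arc 0) s r ∪ plate R.carrier (R.arc 2) s r) δ ω) ⊓ zdGraph 2).Reachable xA xC}
          - (triSitePercolation half).real
            {cfg | (siteOpenGraph triGraph (implantT R.carrier
                (plate R.carrier (R.arc 0) s r ∪ plate R.carrier (R.arc 2) s r) δ cfg)).Reachable yA yC}| ≤ ε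

/-! ## Card `oracle-sandwich` -/

/-- (B1) **Bollobás–Riordan's construction-free sandwich, lower half, for bond `ℤ²`** (the
analogue of the tree's `mem_triCrossing_of_pathIn`, Claim 19 p. 192 + remark p. 195, for EVERY
Jordan conformal rectangle): an open lattice path from an outside vertex near `arc 0` to an outside
vertex near `arc 2`, whose outside vertices are `t`-close to `arc 0 ∪ arc 2` and whose inside
vertices keep off `arc 1 ∪ arc 3` by one mesh, contains a G02 crossing of `Ω_δ` (largest mesh
component, discrete arcs). Deterministic; inputs: `MeshDomainJordan` bulk theorem + run extraction. -/
def MemDiscreteCrossingOfPathIn : Prop :=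
  ∀ R : ConformalRectangle, ∃ δ₀ > 0, ∃ t₀ > 0, ∀ δ t : ℝ, 0 < δ → δ < δ₀ → 0 ≤ t → t ≤ t₀ →
    ∀ (ω : BondConfig (Site 2)) (S : Set (Site 2)) (u v : Site 2),
      (∀ x ∈ S, meshPoint δ x ∉ R.carrier →
        Metric.infDist (meshPoint δ x) (R.arc 0) ≤ t ∨ Metric.infDist (meshPoint δ x) (R.arc 2) ≤ t) →
      (∀ x ∈ S, meshPoint δ x ∈ R.carrier →
        δ < Metric.infDist (meshPoint δ x) (R.arc 1) ∧ δ < Metric.infDist (meshPoint δ x) (R.arc 3)) →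
      meshPoint δ u ∉ R.carrier → Metric.infDist (meshPoint δ u) (R.arc 0) ≤ t →
      meshPoint δ v ∉ R.carrier → Metric.infDist (meshPoint δ v) (R.arc 2) ≤ t →
      PathIn (openGraph ω ⊓ zdGraph 2) S u v →
      ω ∈ discreteCrossing R.carrier δ (R.arc 0) (R.arc 2)

/-- (B2) **Margin robustness on one lattice (Schramm–Smirnov 2011, Lemma 6.1 shape, bond `ℤ²`)**:
G02's crossing probability of `R` exceeds the plate-connectivity probability of its own implant by
at most `ε` once the corner margin `r` and the mesh are small (crossing ⇒ plate connectivity off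
corner events). RSW only; TRUE for `C¹`/polygonal `R`,doubtful for wild `R` — which is exactly why the
sandwich compares a wild `R` with NICE inner domains through (B1) instead. -/
def MarginRobustZ2 : Prop :=
  ∀ (R : ConformalRectangle) (ε s : ℝ), 0 < ε → 0 < s → ∃ r₀ > 0, ∀ r ∈ Set.Ioo (0 : ℝ) r₀,
    ∀ᶠ δ in nhdsWithin (0 : ℝ) (Set.Ioi 0), ∀ xA xC : Site 2,
      meshPoint δ xA ∈ plate R.carrier (R.arc 0) s r → meshPoint δ xC ∈ plate R.carrier (R.arc 2) s r →
      Metric.infDist (meshPoint δ xA) (frontier R.carrier) > s / 2 →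
      Metric.infDist (meshPoint δ xC) (frontier R.carrier) > s / 2 →
      bondDomainCrossingProb R δ ≤
        (bondPercolation (zdGraph 2) half).real
          {ω | (openGraph (implantZ2 R.carrier
              (plate R.carrier (R.arc 0) s r ∪ plate R.carrier (R.arc 2) s r) δ ω) ⊓ zdGraph 2).Reachable xA xC} + ε

/-- (B3) **Oracle sandwich, assembly shape.** With Smirnov's theorem for every `R` (tree:
`hasCrossingLimit_triDomainCrossingProb_holds`) and continuity of `cardyFunction`, it suffices to
bound `bondDomainCrossingProb R δ` above by `F(η) + ε` and below by `F(η) - ε` eventually, for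
every `ε`; the card obtains both bounds from plate comparisons on NICE inner domains via (B1) and
its dual half. Here only the trivial last step is typed: eventual two-sided `ε`-closeness to the
triangular probabilities gives the crux's conclusion. -/
def OracleSandwichAssembly : Prop :=
  (∀ (R : ConformalRectangle) (ε : ℝ), 0 < ε →
      ∀ᶠ δ in nhdsWithin (0 : ℝ) (Set.Ioi 0),
        |bondDomainCrossingProb R δ - triDomainCrossingProb R δ| ≤ ε) →
  ∀ R : ConformalRectangle,
    Filter.Tendsto (fun δ : ℝ ↦ bondDomainCrossingProb R δ - triDomainCrossingProb R δ)
      (nhdsWithin 0 (Set.Ioi 0)) (nhds 0)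

/-- Sanity: (B3) is indeed trivial (so the content of the card is in its hypotheses). -/
example : OracleSandwichAssembly := by
  intro h R
  rw [Metric.tendsto_nhds]
  intro ε hε
  filter_upwards [h R (ε / 2) (by positivity)] with δ hδ
  rw [Real.dist_eq, sub_zero]
  linarith

end Summit.CriticalPhenomena.CardyFormulaZ2.Cruxes.LoopsToCrossings.IdeaSketch
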